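import Summits.BirchSwinnertonDyer.BirchSwinnertonDyer.Theorems.GenusKolyvaginAtTwoGenusPrimitiveSupplyAtTwoConjugationTypeAtTwoNeg
import Literature.NumberTheory.EllipticCurves.HeegnerPointsKolyvaginPrimaryEigenProofs
import Literature.NumberTheory.EllipticCurves.SigmaEulerData
import Literature.NumberTheory.EllipticCurves.HeegnerPointsKolyvaginPrimaryCongruenceProofs
import Literature.NumberTheory.EllipticCurves.IsogenyFrobeniusTraceProofs
import Summits.BirchSwinnertonDyer.BirchSwinnertonDyer.Theorems.GenusKolyvaginAtTwoEquivariantKolyvaginExactAtTwoDescent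
import HarnessLib

/-!
# Route `GenusKolyvaginAtTwo`, LINE 6, KEY crux Q3 `EquivariantKolyvaginExactAtTwo`
# (stmt-BirchSwinnertonDyer-24882): AT A GROSS–KOLYVAGIN PRIME OF A `Δ < 0` CURVE THE `2`-PART OF
# `Ẽ(𝔽_ℓ)` IS CYCLIC, OF ORDER `≥ 2^{M(ℓ)}` (PROVED)

Helper (seat `bsd-line-gk2-p3` g10, cell `bsd-f1-sign2`; `--supports` the item, closes nothing): the
REDUCTION-SIDE half of stub S2 of the eigen/`ℚ_ℓ` architecture of Q3 (kernel-status memo v2,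
evidence #9 on the item). McCallum's Lemma 5.3 needs, at a Kolyvagin prime `ℓ` of level `≥ M`,
*"a duality of CYCLIC groups of order `p^M`"*: `E(K_λ)^±/p^M ≅ ℤ/p^M`. Over `ℚ_ℓ` at `p = 2` on
`Δ(E) < 0` the relevant group is `E(ℚ_ℓ)[2^∞] ≅ Ẽ_ℓ(𝔽_ℓ)[2^∞]` (good reduction, `ℓ` odd), and this
file proves from tree theorems:

* `isAddCyclic_torsionBy_reductionAt_two_pow` — **`Ẽ_ℓ(𝔽_ℓ)[2^k]` is cyclic for every `k`** at a
  Gross–Kolyvagin prime (`FrobEqFrobInfty W K 2 ℓ`, Gross (3.2)) of a globally minimal curve with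
  `Δ < 0`: `#Ẽ_ℓ(𝔽_ℓ)[2] = 2` (sibling `GenusKolySign.natCard_twoTorsion_reductionAt_eq_two_of_frobEqFrobInfty_of_Δ_neg`)
  and a finite group killed by `2^k` with `≤ 2` elements of order `≤ 2` is cyclic (tree
  `KolyvaginEigenPow.isAddCyclic_of_card_torsion_le`, McCallum's Lemma 5.3 algebra at odd `p`, valid
  verbatim at `2`); `natCard_torsionBy_reductionAt_two_pow_dvd` — its order divides `2^k`;
* `eq_of_two_torsion_reductionAt_ne_zero` (at most one point of order `2`) and
  `twoPower_torsion_reductionAt_comparable` — **the `2`-power torsion of `Ẽ_ℓ(𝔽_ℓ)` is a chain**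
  (of two such points one is a multiple of the other; g9's
  `Gorenstein.fixed_comparable_of_unique_fixed_involution` with the trivial involution);
* `two_pow_dvd_natCard_reductionAt` — **`2^M ∣ #Ẽ_ℓ(𝔽_ℓ)` whenever `M ≤ M(ℓ)`** (Zhang's Kolyvagin
  index, `Zhang2014.le_kolyvaginIndex_iff`: `2^M ∣ ℓ + 1`, `2^M ∣ a_ℓ`; point count
  `#Ẽ = ℓ + 1 − a_ℓ`, `residueCard_sub_frobeniusTraceAt_add_one`, `frobeniusTraceAt_eq_frobeniusTrace`).
* (appended) `natCard_torsionBy_eq_of_dvd` (abstract: `#A[2^M] ∣ 2^M` and `2^M ∣ #A` ⟹ `#A[2^M] = 2^M`,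
  Sylow through `Multiplicative A`), `natCard_torsionBy_reductionAt_two_pow_eq` (**`#Ẽ_ℓ(𝔽_ℓ)[2^M] = 2^M`**
  at a Gross–Kolyvagin prime of index `≥ M` on `Δ < 0`), `nonempty_addEquiv_zmod_torsionBy_reductionAt`
  (**`Ẽ_ℓ(𝔽_ℓ)[2^M] ≃+ ZMod (2^M)`**).

Together: at a Zhang–Kolyvagin prime of index `≥ M` with Gross's (3.2) on a `Δ < 0` curve,
`Ẽ_ℓ(𝔽_ℓ)[2^∞]` is cyclic of order `≥ 2^M`, so `Ẽ_ℓ(𝔽_ℓ)/2^M ≅ ℤ/2^M`. Left for S2(a): the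
identification `E(ℚ_ℓ)[2^∞] ≅ Ẽ_ℓ(𝔽_ℓ)[2^∞]` in the tree's `localPoints` currency (reduction injective
on prime-to-`ℓ` torsion, Hensel), and the twin `E^K` (the anti-fixed part, g9's
`antifixed_comparable_of_unique_fixed_involution`). Everything is PROVED from tree theorems (no named
fact, no definition, no `sorry`, standard axioms). BSD is not proved by any of this.

References: [McCallumLMS1991] §4, §5 Lemma 5.3; [GrossLMS1991] §3 (3.2)–(3.3);
[WZhang2014] Notations (xii); [SilvermanAEC2009] Prop. VII.3.1(b), C.§16.
-/

set_option autoImplicit false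
set_option linter.dupNamespace false -- tree convention: `Summit.BirchSwinnertonDyer.BirchSwinnertonDyer.Theorems` (summit = sub-problem)

noncomputable section

open scoped Classical

namespace Summit.BirchSwinnertonDyer.BirchSwinnertonDyer.Theorems.GenusExact.ReductionCyclic

open WeierstrassCurve NumberField IsDedekindDomain
open Literature.NumberTheory.EllipticCurves Literature.NumberTheory.GaloisRepresentations
open Summit.BirchSwinnertonDyer.BirchSwinnertonDyer.Theorems.GenusKolySign

variable (W : WeierstrassCurve ℚ) [W.IsElliptic] [W.IsGloballyMinimal]

/-- **At a Gross–Kolyvagin prime `ℓ` (`Frob(ℓ) = Frob(∞)` on `E[2]`, Gross (3.2)) of a curve with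
`Δ(E) < 0`, every `Ẽ_ℓ(𝔽_ℓ)[2^k]` is CYCLIC.** The reduction has `#Ẽ_ℓ(𝔽_ℓ)[2] = 2` (the sibling
route's `natCard_twoTorsion_reductionAt_eq_two_of_frobEqFrobInfty_of_Δ_neg`: the `2`-division cubic
has exactly one root mod `ℓ`), and a finite abelian group killed by `2^k` whose `2`-torsion has at
most `2` elements is cyclic (the tree's `KolyvaginEigenPow.isAddCyclic_of_card_torsion_le`, written
for McCallum's Lemma 5.3 at odd `p`, valid verbatim at `p = 2`). This is the reduction-side half of
«`E(ℚ_ℓ)[2^∞]` is cyclic at every Kolyvagin prime on `Δ < 0`» (g9's `…Descent` §6 in the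
abstract; stub S2 of the kernel-status memo): McCallum's *"duality of CYCLIC groups of order `p^M`"*
holds over `ℚ_ℓ` at `2`. [cite: McCallumLMS1991, §5 Lemma 5.3] [cite: GrossLMS1991, §3 (3.2)]
[cite: SilvermanAEC2009, Prop. VII.3.1(b)] -/
theorem isAddCyclic_torsionBy_reductionAt_two_pow (hΔ : W.Δ < 0) {K : Type} [Field K] [NumberField K]
    {ℓ : ℕ} [Fact ℓ.Prime] (hℓ2 : ℓ ≠ 2) (hgoodℓ : W.HasGoodReductionAtPrime ℓ)
    (hℓ : FrobEqFrobInfty W K 2 ℓ) {v : HeightOneSpectrum (𝓞 ℚ)} (hv : (ℓ : 𝓞 ℚ) ∈ v.asIdeal)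
    (k : ℕ) :
    IsAddCyclic (AddSubgroup.torsionBy (W.reductionAt v).toAffine.Point ((2 ^ k : ℕ) : ℤ)) := by
  haveI : Finite (W.reductionAt v).toAffine.Point := W.finite_point_reductionAt v
  have h2 := natCard_twoTorsion_reductionAt_eq_two_of_frobEqFrobInfty_of_Δ_neg W hΔ hℓ2 hgoodℓ hℓ hv
  set G := AddSubgroup.torsionBy (W.reductionAt v).toAffine.Point ((2 ^ k : ℕ) : ℤ) with hG
  refine KolyvaginEigenPow.isAddCyclic_of_card_torsion_le (p := 2) (M := k) Nat.prime_two
    (fun g ↦ AddSubgroup.torsionBy.nsmul g) ?_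
  -- `{g ∈ G | 2g = 0} ↪ Ẽ(𝔽_ℓ)[2]`, which has two elements
  have hle : Nat.card {g : G // 2 • g = 0} ≤
      Nat.card (AddSubgroup.torsionBy (W.reductionAt v).toAffine.Point ((2 : ℕ) : ℤ)) := by
    refine Nat.card_le_card_of_injective
      (fun g ↦ ⟨((g.1 : G) : (W.reductionAt v).toAffine.Point),
        AddSubgroup.torsionBy.nsmul_iff.mpr (by
          have h := congrArg Subtype.val g.2
          simpa only [AddSubmonoidClass.coe_nsmul, ZeroMemClass.coe_zero] using h)⟩) ?_
    intro g g' h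
    have h' := congrArg Subtype.val h
    exact Subtype.ext (Subtype.ext h')
  exact hle.trans h2.le

/-- **… hence `#Ẽ_ℓ(𝔽_ℓ)[2^k] ∣ 2^k`** (a cyclic group killed by `2^k`).
[cite: McCallumLMS1991, §5 Lemma 5.3] -/
theorem natCard_torsionBy_reductionAt_two_pow_dvd (hΔ : W.Δ < 0) {K : Type} [Field K]
    [NumberField K] {ℓ : ℕ} [Fact ℓ.Prime] (hℓ2 : ℓ ≠ 2) (hgoodℓ : W.HasGoodReductionAtPrime ℓ)
    (hℓ : FrobEqFrobInfty W K 2 ℓ) {v : HeightOneSpectrum (𝓞 ℚ)} (hv : (ℓ : 𝓞 ℚ) ∈ v.asIdeal)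
    (k : ℕ) :
    Nat.card (AddSubgroup.torsionBy (W.reductionAt v).toAffine.Point ((2 ^ k : ℕ) : ℤ)) ∣ 2 ^ k := by
  haveI : Finite (W.reductionAt v).toAffine.Point := W.finite_point_reductionAt v
  haveI := isAddCyclic_torsionBy_reductionAt_two_pow W hΔ hℓ2 hgoodℓ hℓ hv k
  rw [← IsAddCyclic.exponent_eq_card]
  exact AddMonoid.exponent_dvd_of_forall_nsmul_eq_zero fun g ↦ AddSubgroup.torsionBy.nsmul g

/-- **At most one point of order `2`**: `#Ẽ_ℓ(𝔽_ℓ)[2] = 2` means `Ẽ_ℓ(𝔽_ℓ)[2] = {0, T₀}`, so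
two non-zero `2`-torsion points coincide (the uniqueness input of g9's comparability lemma).
[cite: SilvermanAEC2009, Prop. VII.3.1(b)] -/
theorem eq_of_two_torsion_reductionAt_ne_zero (hΔ : W.Δ < 0) {K : Type} [Field K] [NumberField K]
    {ℓ : ℕ} [Fact ℓ.Prime] (hℓ2 : ℓ ≠ 2) (hgoodℓ : W.HasGoodReductionAtPrime ℓ)
    (hℓ : FrobEqFrobInfty W K 2 ℓ) {v : HeightOneSpectrum (𝓞 ℚ)} (hv : (ℓ : 𝓞 ℚ) ∈ v.asIdeal)
    {P Q : (W.reductionAt v).toAffine.Point} (hP : (2 : ℤ) • P = 0) (hQ : (2 : ℤ) • Q = 0)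
    (hP0 : P ≠ 0) (hQ0 : Q ≠ 0) : P = Q := by
  have h2 := natCard_twoTorsion_reductionAt_eq_two_of_frobEqFrobInfty_of_Δ_neg W hΔ hℓ2 hgoodℓ hℓ hv
  rw [Nat.card_eq_two_iff] at h2
  obtain ⟨x, y, hxy, huniv⟩ := h2
  have hmem : ∀ z : AddSubgroup.torsionBy (W.reductionAt v).toAffine.Point ((2 : ℕ) : ℤ),
      z = x ∨ z = y := fun z ↦ by
    have hz : z ∈ ({x, y} : Set _) := by rw [huniv]; exact Set.mem_univ z
    simpa using hz
  have hP' : P ∈ AddSubgroup.torsionBy (W.reductionAt v).toAffine.Point ((2 : ℕ) : ℤ) := by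
    simpa using hP
  have hQ' : Q ∈ AddSubgroup.torsionBy (W.reductionAt v).toAffine.Point ((2 : ℕ) : ℤ) := by
    simpa using hQ
  have h0 : (0 : (W.reductionAt v).toAffine.Point) ∈
      AddSubgroup.torsionBy (W.reductionAt v).toAffine.Point ((2 : ℕ) : ℤ) := zero_mem _
  -- `0`, `P`, `Q` are among `x, y`; `P, Q ≠ 0` forces `P = Q`
  rcases hmem ⟨0, h0⟩ with h0x | h0y
  · rcases hmem ⟨P, hP'⟩ with hPx | hPy
    · exact absurd (congrArg Subtype.val (hPx.trans h0x.symm)) hP0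
    · rcases hmem ⟨Q, hQ'⟩ with hQx | hQy
      · exact absurd (congrArg Subtype.val (hQx.trans h0x.symm)) hQ0
      · exact congrArg Subtype.val (hPy.trans hQy.symm)
  · rcases hmem ⟨P, hP'⟩ with hPx | hPy
    · rcases hmem ⟨Q, hQ'⟩ with hQx | hQy
      · exact congrArg Subtype.val (hPx.trans hQx.symm)
      · exact absurd (congrArg Subtype.val (hQy.trans h0y.symm)) hQ0
    · exact absurd (congrArg Subtype.val (hPy.trans h0y.symm)) hP0

/-- **The `2`-primary part of `Ẽ_ℓ(𝔽_ℓ)` is a CHAIN**: of any two points of `2`-power order, one is a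
multiple of the other (g9's `Gorenstein.fixed_comparable_of_unique_fixed_involution` with the trivial
involution, fed by `eq_of_two_torsion_reductionAt_ne_zero`). With the count `#Ẽ(𝔽_ℓ) = ℓ + 1 − a_ℓ`
(`2^M ∣ ℓ + 1`, `2^M ∣ a_ℓ` at a prime of Kolyvagin index `≥ M`) this makes `Ẽ_ℓ(𝔽_ℓ)[2^M]` cyclic
of order `2^M` — McCallum's Lemma 5.3 (i) over `ℚ_ℓ` at `2`. [cite: McCallumLMS1991, §5 Lemma 5.3]
[cite: GrossLMS1991, §3 (3.3)] -/
theorem twoPower_torsion_reductionAt_comparable (hΔ : W.Δ < 0) {K : Type} [Field K] [NumberField K]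
    {ℓ : ℕ} [Fact ℓ.Prime] (hℓ2 : ℓ ≠ 2) (hgoodℓ : W.HasGoodReductionAtPrime ℓ)
    (hℓ : FrobEqFrobInfty W K 2 ℓ) {v : HeightOneSpectrum (𝓞 ℚ)} (hv : (ℓ : 𝓞 ℚ) ∈ v.asIdeal)
    (k : ℕ) (s t : (W.reductionAt v).toAffine.Point) (hs : (2 : ℤ) ^ k • s = 0)
    (ht : (2 : ℤ) ^ k • t = 0) : (∃ n : ℤ, s = n • t) ∨ ∃ n : ℤ, t = n • s :=
  Gorenstein.fixed_comparable_of_unique_fixed_involution (AddMonoidHom.id _)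
    (fun _ _ hu hw _ _ hu0 hw0 ↦
      eq_of_two_torsion_reductionAt_ne_zero W hΔ hℓ2 hgoodℓ hℓ hv hu hw hu0 hw0)
    k s t hs ht rfl rfl

/-- **`2^M ∣ #Ẽ_ℓ(𝔽_ℓ)` at a prime of Kolyvagin index `≥ M`** (Zhang's `M(ℓ) = min(v₂(ℓ+1), v₂(a_ℓ))`,
tree `Zhang2014.kolyvaginIndex`; McCallum §4: *"`p^M` divides both `l + 1` and `a_l`"*): the point
count `#Ẽ_ℓ(𝔽_ℓ) = ℓ + 1 − a_ℓ` (`residueCard_sub_frobeniusTraceAt_add_one`,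
`frobeniusTraceAt_eq_frobeniusTrace`). With the cyclicity above: `Ẽ_ℓ(𝔽_ℓ)[2^∞]` is cyclic of order
`≥ 2^M`, so `Ẽ_ℓ(𝔽_ℓ)/2^M ≅ ℤ/2^M` — McCallum's Lemma 5.3 (i) over `ℚ_ℓ` at `2` on `Δ < 0`.
[cite: McCallumLMS1991, §4 and §5 Lemma 5.3] [cite: WZhang2014, Notations (xii)] -/
theorem two_pow_dvd_natCard_reductionAt {ℓ : ℕ} (hℓ : ℓ.Prime) {M : ℕ}
    (hM : M ≤ Zhang2014.kolyvaginIndex W 2 ℓ) {v : HeightOneSpectrum (𝓞 ℚ)}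
    (hv : (ℓ : 𝓞 ℚ) ∈ v.asIdeal) :
    2 ^ M ∣ Nat.card (W.reductionAt v).toAffine.Point := by
  haveI : Fact (Nat.Prime 2) := ⟨Nat.prime_two⟩
  obtain ⟨h1, h2⟩ := (Zhang2014.le_kolyvaginIndex_iff (W := W) (p := 2)).mp hM
  have hcount := W.residueCard_sub_frobeniusTraceAt_add_one v
  rw [residueCard_eq_of_natCast_mem_rat hℓ hv, frobeniusTraceAt_eq_frobeniusTrace,
    primesEquiv_eq_of_natCast_mem hℓ hv] at hcount
  -- `#Ẽ = ℓ + 1 - a_ℓ` in `ℤ`, and `2^M` divides both `ℓ + 1` and `a_ℓ`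
  have hZ : ((2 ^ M : ℕ) : ℤ) ∣ (Nat.card (W.reductionAt v).toAffine.Point : ℤ) := by
    rw [← hcount, show (ℓ : ℤ) - W.frobeniusTrace ℓ + 1 = ((ℓ + 1 : ℕ) : ℤ) - W.frobeniusTrace ℓ by
      push_cast; ring]
    exact dvd_sub (Int.natCast_dvd_natCast.mpr h1) (by exact_mod_cast h2)
  exact Int.natCast_dvd_natCast.mp hZ

/-! ## Exact order: `#Ẽ_ℓ(𝔽_ℓ)[2^M] = 2^M` at a prime of Kolyvagin index `≥ M` -/

/-- **Abstract step**: in a finite abelian group `A` with `#A[2^M] ∣ 2^M` (e.g. `A[2^M]` cyclic) and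
`2^M ∣ #A`, in fact `#A[2^M] = 2^M`: Sylow's theorem (Mathlib, through `Multiplicative A`) gives a
subgroup of order `2^M`, whose elements are killed by `2^M` (Lagrange), hence lie in `A[2^M]`.
[folklore] -/
theorem natCard_torsionBy_eq_of_dvd {A : Type*} [AddCommGroup A] [Finite A] {M : ℕ}
    (hle : Nat.card (AddSubgroup.torsionBy A ((2 ^ M : ℕ) : ℤ)) ∣ 2 ^ M)
    (hdvd : 2 ^ M ∣ Nat.card A) :
    Nat.card (AddSubgroup.torsionBy A ((2 ^ M : ℕ) : ℤ)) = 2 ^ M := by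
  haveI : Fact (Nat.Prime 2) := ⟨Nat.prime_two⟩
  have hdvd' : 2 ^ M ∣ Nat.card (Multiplicative A) := hdvd
  obtain ⟨K, hK⟩ := Sylow.exists_subgroup_card_pow_prime 2 hdvd'
  -- every element of `K` is killed by `2^M`
  have hmem : ∀ x : Multiplicative A, x ∈ K →
      Multiplicative.toAdd x ∈ AddSubgroup.torsionBy A ((2 ^ M : ℕ) : ℤ) := by
    intro x hx
    refine AddSubgroup.torsionBy.nsmul_iff.mpr ?_
    have h : (⟨x, hx⟩ : K) ^ Nat.card K = 1 := pow_card_eq_one'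
    rw [hK] at h
    have h' := congrArg (fun y : K ↦ Multiplicative.toAdd (y : Multiplicative A)) h
    simpa using h'
  have hcard : 2 ^ M ≤ Nat.card (AddSubgroup.torsionBy A ((2 ^ M : ℕ) : ℤ)) := by
    have hinj : Nat.card K ≤ Nat.card (AddSubgroup.torsionBy A ((2 ^ M : ℕ) : ℤ)) := by
      refine Nat.card_le_card_of_injective
        (fun x : K ↦ (⟨Multiplicative.toAdd x.1, hmem x.1 x.2⟩ :
          AddSubgroup.torsionBy A ((2 ^ M : ℕ) : ℤ))) ?_
      intro x y h
      have h' := congrArg Subtype.val h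
      exact Subtype.ext h'
    exact hK ▸ hinj
  exact le_antisymm (Nat.le_of_dvd (by positivity) hle) hcard

/-- **`#Ẽ_ℓ(𝔽_ℓ)[2^M] = 2^M` at a Gross–Kolyvagin prime of Kolyvagin index `≥ M` on `Δ(E) < 0`**:
`Ẽ_ℓ(𝔽_ℓ)[2^M]` is cyclic of order dividing `2^M` and `2^M ∣ #Ẽ_ℓ(𝔽_ℓ)`. This is McCallum's
Lemma 5.3 (i) *"cyclic groups of order `p^M`"* for `E(ℚ_ℓ)[2^∞] ≅ Ẽ_ℓ(𝔽_ℓ)[2^∞]` at `p = 2`, reduction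
side: `Ẽ_ℓ(𝔽_ℓ)/2^M ≅ Ẽ_ℓ(𝔽_ℓ)[2^M] ≅ ℤ/2^M`. [cite: McCallumLMS1991, §5 Lemma 5.3]
[cite: GrossLMS1991, §3 (3.2)–(3.3)] [cite: WZhang2014, Notations (xii)] -/
theorem natCard_torsionBy_reductionAt_two_pow_eq (hΔ : W.Δ < 0) {K : Type} [Field K] [NumberField K]
    {ℓ : ℕ} [Fact ℓ.Prime] (hℓ2 : ℓ ≠ 2) (hgoodℓ : W.HasGoodReductionAtPrime ℓ)
    (hℓ : FrobEqFrobInfty W K 2 ℓ) {v : HeightOneSpectrum (𝓞 ℚ)} (hv : (ℓ : 𝓞 ℚ) ∈ v.asIdeal)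
    {M : ℕ} (hM : M ≤ Zhang2014.kolyvaginIndex W 2 ℓ) :
    Nat.card (AddSubgroup.torsionBy (W.reductionAt v).toAffine.Point ((2 ^ M : ℕ) : ℤ)) = 2 ^ M := by
  haveI : Finite (W.reductionAt v).toAffine.Point := W.finite_point_reductionAt v
  exact natCard_torsionBy_eq_of_dvd (natCard_torsionBy_reductionAt_two_pow_dvd W hΔ hℓ2 hgoodℓ hℓ hv M)
    (two_pow_dvd_natCard_reductionAt W Fact.out hM hv)

/-- **… and it is cyclic of order `2^M`**: `Ẽ_ℓ(𝔽_ℓ)[2^M] ≃+ ZMod (2^M)` exists (a cyclic group is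
determined by its order). [cite: McCallumLMS1991, §5 Lemma 5.3] -/
theorem nonempty_addEquiv_zmod_torsionBy_reductionAt (hΔ : W.Δ < 0) {K : Type} [Field K]
    [NumberField K] {ℓ : ℕ} [Fact ℓ.Prime] (hℓ2 : ℓ ≠ 2) (hgoodℓ : W.HasGoodReductionAtPrime ℓ)
    (hℓ : FrobEqFrobInfty W K 2 ℓ) {v : HeightOneSpectrum (𝓞 ℚ)} (hv : (ℓ : 𝓞 ℚ) ∈ v.asIdeal)
    {M : ℕ} (hM : M ≤ Zhang2014.kolyvaginIndex W 2 ℓ) :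
    Nonempty (AddSubgroup.torsionBy (W.reductionAt v).toAffine.Point ((2 ^ M : ℕ) : ℤ) ≃+ ZMod (2 ^ M)) := by
  haveI : Finite (W.reductionAt v).toAffine.Point := W.finite_point_reductionAt v
  haveI := isAddCyclic_torsionBy_reductionAt_two_pow W hΔ hℓ2 hgoodℓ hℓ hv M
  have hcard := natCard_torsionBy_reductionAt_two_pow_eq W hΔ hℓ2 hgoodℓ hℓ hv hM
  exact ⟨(hcard ▸ (zmodAddCyclicAddEquiv inferInstance).symm :)⟩

end Summit.BirchSwinnertonDyer.BirchSwinnertonDyer.Theorems.GenusExact.ReductionCyclic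

end
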